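import Summits.MatrixMultiplication.OmegaCensus.STPP222SqReflect

/-!
# ω-census, `(2,2,2)²` is infeasible in `ℤ/23` — kernel search, part 3 of 3

HONEST FRAMING (pub-omega census; verbatim): lottery ticket; floor = certified bounds/negative ranges.
Census STRUCTURE bookkeeping (question Q7, row `k = 2`, lower half), not progress on `ω`.

Chunks 32–37 of the kernel search (`STPP222SqSearch.searchB`, `decide +kernel`) over the canonical start list of
`ℤ/23`; assembled with the covering facts in `STPP222SqNoneZ23.lean`.  Data generated by `pub-omega-eng2-g17/work/k2neg/groupgen2.py`.

References: H. Cohn, R. Kleinberg, B. Szegedy, C. Umans, FOCS 2005 (arXiv:math/0511460), Def. 5.1.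
-/

namespace Summit.MatrixMultiplication.OmegaCensus

namespace STPP222SqNeg

/-- Kernel search over start-list chunk 32 of `ℤ/23` (1 entries, 29972 Def-5.1 clause evaluations predicted). -/
theorem Z23.s32 : searchB (zmodOps 23) (List.range 23) (fun x : ℕ => x)
  ([(1, 7, 9, (List.range 23))] : List (ℕ × ℕ × ℕ × List ℕ)) = true := by
  decide +kernel

/-- Kernel search over start-list chunk 33 of `ℤ/23` (1 entries, 26713 Def-5.1 clause evaluations predicted). -/
theorem Z23.s33 : searchB (zmodOps 23) (List.range 23) (fun x : ℕ => x)
  ([(1, 7, 10, (List.range 23))] : List (ℕ × ℕ × ℕ × List ℕ)) = true := by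
  decide +kernel

/-- Kernel search over start-list chunk 34 of `ℤ/23` (1 entries, 25340 Def-5.1 clause evaluations predicted). -/
theorem Z23.s34 : searchB (zmodOps 23) (List.range 23) (fun x : ℕ => x)
  ([(1, 7, 11, (List.range 23))] : List (ℕ × ℕ × ℕ × List ℕ)) = true := by
  decide +kernel

/-- Kernel search over start-list chunk 35 of `ℤ/23` (1 entries, 27658 Def-5.1 clause evaluations predicted). -/
theorem Z23.s35 : searchB (zmodOps 23) (List.range 23) (fun x : ℕ => x)
  ([(1, 8, 10, (List.range 23))] : List (ℕ × ℕ × ℕ × List ℕ)) = true := by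
  decide +kernel

/-- Kernel search over start-list chunk 36 of `ℤ/23` (1 entries, 24758 Def-5.1 clause evaluations predicted). -/
theorem Z23.s36 : searchB (zmodOps 23) (List.range 23) (fun x : ℕ => x)
  ([(1, 8, 11, (List.range 23))] : List (ℕ × ℕ × ℕ × List ℕ)) = true := by
  decide +kernel

/-- Kernel search over start-list chunk 37 of `ℤ/23` (1 entries, 29312 Def-5.1 clause evaluations predicted). -/
theorem Z23.s37 : searchB (zmodOps 23) (List.range 23) (fun x : ℕ => x)
  ([(1, 9, 11, (List.range 23))] : List (ℕ × ℕ × ℕ × List ℕ)) = true := by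
  decide +kernel

end STPP222SqNeg

end Summit.MatrixMultiplication.OmegaCensus
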